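import Literature.NumberTheory.Automorphic.ArchCartanNormalisers     -- ★ (COORD): `RegS ∕ InRegS`, `angleShift ∕ flipAt ∕ negXAt`, `archRH` (Shelstad's `R_T`)
import Mathlib.Analysis.Calculus.BumpFunction.FiniteDimension
import HarnessLib

/-!
# `ArchBouazizSpaceH`, PART 1: the four elementary clauses of Bouaziz's space `I^st_c(H_∞)` on Cartan-indexed families — periodicity (P), stable Weyl symmetry (W),
# smooth-bounded on `T_{in-reg}` (I₁)+(I₂), compact support modulo conjugation (I₄) — with a NON-ZERO inhabitant and rejected families
# (Bouaziz 1994 §3.1–3.2 pp. 579–581, §6.2 p. 591; Shelstad 1979 §4 pp. 22–26)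

Topic `NumberTheory/Rogawski1990`; namespace `Literature.NumberTheory.Rogawski1990`.  Definitions WITH BODIES and theorems only (no instance, no notation, no axiom, no named
fact, no `sorry`).  Cell `pub/hodgecm-mathlib`, line LH3 (closer stub `stub_N9`, crux H413 = `stmt-HodgeConjecture-24833`); organ **(D2-P1)** of the LH3 direct road (LH3-plan (g2)
DEALER WORDS #7; D2-SPEC v1 §3 as amended by the v2 RULINGS F1–F8 of 2026-09-02T05:24:30Z; LHref-N pre-flags Q1∕Q2).  PART 2 = the jump clause (I₃) `ArchBzJump` (LH7-p02 (g2),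
`ArchBouazizJumpClause`); PART 3 = the family `Ψfam mH fH` of a test function and the conjunction `ArchBouazizSpaceH` (after the atlas (T-ATLAS), LH3-p03 (g2)).  Author LH3-p01 (g3).

THE FAMILIES.  A candidate element of `I^st_c(H_∞)` is read on EVERY Cartan class at once: `Ψ : Finset W → (W → Fin 3 → ℝ) → ℂ`, `Ψ S` = the NORMALISED (`R_T ·`) stable
orbital function on the Cartan of type `S` (split places `S`), in the coordinates of ★ `ArchCartanCoordinates` (generic finite index `W`; the line instantiates
`W := {w : InfinitePlace L // IsComplex w}`).

THE CLAUSES (each a separate `def … : Prop`, LHref-N: clause-by-clause boxing).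
* (P)  `ArchBzPeriodic Ψ` — `2π`-periodic in every ANGLE coordinate (`w ∉ S ∨ i ≠ 0`; the split coordinate `x = c w 0`, `w ∈ S`, is not an angle).
* (W)  `ArchBzWeyl Ψ` — Shelstad's (II) «`Ψ(γ^ω) = det ω · ξ_{ι−ω⁻¹ι}(γ) · Ψ(γ)`» in DIVISION-FREE form: at a compact place the stable (non-realised) flip twists by the character
  `archRH S (flipAt w c) ∕ archRH S c = −e^{i(θ₀−θ₂)}` (★ `archRH_flipAt`), stated as `Ψ S (flipAt w c) · R(c) = R(flipAt w c) · Ψ S c`; at a split place the realised real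
  reflection `x ↦ −x` is a PLAIN symmetry (`R` is even there, ★ `archRH_negXAt`).
* (I₁)+(I₂) BUNDLED (v2 ruling): `ArchBzSmoothBounded Ψ` — `Ψ S` is `C^∞` on Bouaziz's `T_{in-reg}` = `InRegS S` (ACROSS the real walls `x_w = 0`, Harish-Chandra ∕ Rao; only the
  imaginary walls removed) and every `iteratedFDeriv` is bounded on `K ∩ InRegS S` for every compact `K` («toutes ses dérivées y sont bornées» on `H_reg ∩ ω`).  Smoothness
  class `∞ = ((⊤ : ℕ∞) : WithTop ℕ∞)`, NEVER `⊤ = ω` (ruling F1); plain `iteratedFDeriv` on the open set (ruling F5).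
* (I₄)  `ArchBzCompactSupport Ψ` — bounded split coordinates: `Ψ S c = 0` as soon as some `|x_w|`, `w ∈ S`, exceeds a bound (compact support modulo conjugation and periodicity).
NOT HERE: (I₃) the jump relations (PART 2); the Schwartz decay of Shelstad's (III) is replaced by (I₄)+(I₁) (Bouaziz's point).

NON-VACUITY (Q1) and NON-TRIVIALITY (Q2), in-file.  `bzBumpFamily` — the totally split family `Ψ univ c = ∏_w β(x_w)` with `β` an EVEN smooth bump supported in
`1 ≤ |x| ≤ 2` (flat at every real wall, so the future (I₃) reads `0 = jc · 0`), `Ψ S = 0` for `S ≠ univ` — satisfies (P)(W)(I₁+I₂)(I₄) and is NOT zero (Shelstad's Lemma 4.8 (b)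
phenomenon).  Rejections: (P) rejects the coordinate family `c ↦ c w 1`, (W) rejects `c ↦ x_w` on a split chart, (I₄) rejects the constant family `1`.
HONEST LABEL: HC_CM is proved only modulo the 7 printed citations (2 remaining: hLiu418 = stmt-HodgeConjecture-24832, h413 = stmt-HodgeConjecture-24833) until rung 0 closes; this
file types clauses of a LETTER's target space and pays nothing by itself.

## References
* [Bouaziz1994IntegralesOrbitales] A. Bouaziz, *Intégrales orbitales sur les groupes de Lie réductifs*, Ann. Sci. ÉNS 27 (1994) 573–609, §3.1–3.2 pp. 579–581 (`I(U)`: (I₁)–(I₄)),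
  §6.2 p. 591 (`I^st`, `T^st_{in-reg}`), Thm. 6.2.1 (i) p. 592.
* [Shelstad1979] D. Shelstad, *Characters and inner forms of a quasi-split group over ℝ*, Compositio Math. 39 (1979), §4 pp. 22–26 ((I)–(III), Lemma 4.8).
* [Rogawski1990] J. D. Rogawski, *Automorphic Representations of Unitary Groups in Three Variables*, Ann. of Math. Stud. 123 (1990), §14.3 p. 234 (`H_∞`), §4.9 p. 55.
-/

set_option autoImplicit false

noncomputable section

open Complex Set Function Real
open scoped ContDiff
open Literature.NumberTheory.Automorphic.ArchCartan

namespace Literature.NumberTheory.Rogawski1990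

variable {W : Type*}

/-! ## §1 The four elementary clauses -/

section Periodic

variable [DecidableEq W]

/-- **(P) `ArchBzPeriodic Ψ`** — every member `Ψ S` is `2π`-periodic in each ANGLE coordinate: `Ψ S (c + 2πk·δ_{(w,i)}) = Ψ S c` whenever `(w, i)` is an angle slot of the chart
`S` (`w ∉ S`, or `i ≠ 0`; at a split place slot `0` is the non-periodic `x`).  [cite: Shelstad1979, §4 p. 22] [cite: Bouaziz1994IntegralesOrbitales, §3.1 p. 579] -/
def ArchBzPeriodic (Ψ : Finset W → (W → Fin 3 → ℝ) → ℂ) : Prop :=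
  ∀ (S : Finset W) (c : W → Fin 3 → ℝ) (w : W) (i : Fin 3) (k : ℤ), (w ∉ S ∨ i ≠ 0) → Ψ S (c + angleShift w i k) = Ψ S c

/-- Unfolding of (P). [cite: Shelstad1979, §4 p. 22] -/
theorem archBzPeriodic_iff (Ψ : Finset W → (W → Fin 3 → ℝ) → ℂ) :
    ArchBzPeriodic Ψ ↔ ∀ (S : Finset W) (c : W → Fin 3 → ℝ) (w : W) (i : Fin 3) (k : ℤ), (w ∉ S ∨ i ≠ 0) → Ψ S (c + angleShift w i k) = Ψ S c :=
  Iff.rfl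

/-- The zero family satisfies (P). [cite: Shelstad1979, §4 p. 22] -/
theorem archBzPeriodic_zero : ArchBzPeriodic (fun (_ : Finset W) (_ : W → Fin 3 → ℝ) => (0 : ℂ)) :=
  fun _ _ _ _ _ _ => rfl

/-- (P) rejects the bare angle coordinate `c ↦ c w₀ 1` (not periodic). [cite: Shelstad1979, §4 p. 22] -/
theorem not_archBzPeriodic_coord (w₀ : W) : ¬ ArchBzPeriodic (fun (_ : Finset W) (c : W → Fin 3 → ℝ) => (c w₀ 1 : ℂ)) := by
  intro h
  have h1 := h ∅ 0 w₀ 1 1 (Or.inr one_ne_zero)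
  simp only [Pi.add_apply, Pi.zero_apply, zero_add, angleShift_apply_self, Int.cast_one, mul_one, Complex.ofReal_inj] at h1
  exact (mul_ne_zero two_ne_zero Real.pi_ne_zero) h1

end Periodic

section Weyl

variable [Fintype W] [DecidableEq W]

/-- **(W) `ArchBzWeyl Ψ`** — stable Weyl symmetry of the normalised families, DIVISION-FREE (Shelstad (II): `Ψ(γ^ω) = det(ω) ξ_{ι−ω⁻¹ι}(γ) Ψ(γ)`): at a compact place `w ∉ S` the
(stably realised) flip `θ₀ ↔ θ₂` satisfies `Ψ S (flipAt w c) · R_S(c) = R_S(flipAt w c) · Ψ S c` (the un-normalised family is flip-invariant; the character is ★ `archRH_flipAt`);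
at a split place `w ∈ S` the realised real reflection `x ↦ −x` is a plain symmetry (`R_S` is even, ★ `archRH_negXAt`). [cite: Shelstad1979, §4 p. 23]
[cite: Bouaziz1994IntegralesOrbitales, §6.2 p. 591] -/
def ArchBzWeyl (Ψ : Finset W → (W → Fin 3 → ℝ) → ℂ) : Prop :=
  (∀ (S : Finset W) (c : W → Fin 3 → ℝ) (w : W), w ∉ S → Ψ S (flipAt w c) * archRH S c = archRH S (flipAt w c) * Ψ S c) ∧
    ∀ (S : Finset W) (c : W → Fin 3 → ℝ) (w : W), w ∈ S → Ψ S (negXAt w c) = Ψ S c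

/-- The zero family satisfies (W). [cite: Shelstad1979, §4 p. 23] -/
theorem archBzWeyl_zero : ArchBzWeyl (fun (_ : Finset W) (_ : W → Fin 3 → ℝ) => (0 : ℂ)) :=
  ⟨fun _ _ _ _ => by rw [zero_mul, mul_zero], fun _ _ _ _ => rfl⟩

/-- (W) rejects the bare split coordinate `c ↦ x_{w₀}` on a chart where `w₀` is split (it is odd, not even, under `x ↦ −x`). [cite: Shelstad1979, §4 p. 23] -/
theorem not_archBzWeyl_coord (w₀ : W) : ¬ ArchBzWeyl (fun (_ : Finset W) (c : W → Fin 3 → ℝ) => (c w₀ 0 : ℂ)) := by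
  intro h
  have h1 := h.2 {w₀} (fun _ _ => 1) w₀ (Finset.mem_singleton_self w₀)
  simp only [negXAt_apply_self, Matrix.cons_val_zero] at h1
  norm_num at h1

end Weyl

section Smooth

variable [Fintype W]

/-- **(I₁)+(I₂) `ArchBzSmoothBounded Ψ`** (v2 ruling: (I₂) bundled into (I₁)) — every member is `C^∞` on Bouaziz's `T_{in-reg}` (★ `InRegS S`: across the real walls, only the
imaginary walls removed) and each derivative is bounded on the in-regular part of every compact set: Bouaziz (I₁) «`φ` est de classe `C^∞` sur `H_reg` … ainsi que toutes
ses dérivées y sont bornées» + (I₂) «`b_Ψ φ` se prolonge en une fonction `C^∞` sur `H_{Ψ-reg}`».  `∞` is the smooth class (not `ω`); `iteratedFDeriv` is the plain one, legitimate on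
the OPEN set ★ `isOpen_inRegS`. [cite: Bouaziz1994IntegralesOrbitales, §3.1 p. 579] [cite: Shelstad1979, §4 p. 23] -/
def ArchBzSmoothBounded (Ψ : Finset W → (W → Fin 3 → ℝ) → ℂ) : Prop :=
  ∀ S : Finset W, ContDiffOn ℝ ∞ (Ψ S) (InRegS S) ∧
    ∀ (n : ℕ) (K : Set (W → Fin 3 → ℝ)), IsCompact K → BddAbove ((fun c => ‖iteratedFDeriv ℝ n (Ψ S) c‖) '' (K ∩ InRegS S))

/-- Unfolding of (I₁)+(I₂). [cite: Bouaziz1994IntegralesOrbitales, §3.1 p. 579] -/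
theorem archBzSmoothBounded_iff (Ψ : Finset W → (W → Fin 3 → ℝ) → ℂ) :
    ArchBzSmoothBounded Ψ ↔ ∀ S : Finset W, ContDiffOn ℝ ∞ (Ψ S) (InRegS S) ∧
      ∀ (n : ℕ) (K : Set (W → Fin 3 → ℝ)), IsCompact K → BddAbove ((fun c => ‖iteratedFDeriv ℝ n (Ψ S) c‖) '' (K ∩ InRegS S)) :=
  Iff.rfl

/-- (I₁) read on the regular set: a smooth-bounded family is `C^∞` on `RegS S ⊆ InRegS S`. [cite: Bouaziz1994IntegralesOrbitales, §3.1 p. 579] -/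
theorem ArchBzSmoothBounded.contDiffOn_regS {Ψ : Finset W → (W → Fin 3 → ℝ) → ℂ} (h : ArchBzSmoothBounded Ψ) (S : Finset W) :
    ContDiffOn ℝ ∞ (Ψ S) (RegS S) :=
  (h S).1.mono (regS_subset_inRegS S)

/-- The zero family satisfies (I₁)+(I₂). [cite: Bouaziz1994IntegralesOrbitales, §3.1 p. 579] -/
theorem archBzSmoothBounded_zero : ArchBzSmoothBounded (fun (_ : Finset W) (_ : W → Fin 3 → ℝ) => (0 : ℂ)) := by
  intro S
  refine ⟨contDiffOn_const, fun n K _ => ⟨0, ?_⟩⟩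
  rintro _ ⟨c, _, rfl⟩
  simp only [iteratedFDeriv_fun_zero, Pi.zero_apply, norm_zero, le_refl]

end Smooth

section Support

/-- **(I₄) `ArchBzCompactSupport Ψ`** — compact support modulo conjugation (and periodicity): on each chart the split coordinates of the support are bounded, i.e. `Ψ S c = 0`
once some `|x_w|`, `w ∈ S`, exceeds a bound `Rb`. [cite: Bouaziz1994IntegralesOrbitales, §3.1 p. 579] -/
def ArchBzCompactSupport (Ψ : Finset W → (W → Fin 3 → ℝ) → ℂ) : Prop :=
  ∀ S : Finset W, ∃ Rb : ℝ, ∀ c : W → Fin 3 → ℝ, (∃ w ∈ S, Rb < |c w 0|) → Ψ S c = 0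

/-- The zero family satisfies (I₄) (and, below, every clause): the clauses are not contradictory. [cite: Bouaziz1994IntegralesOrbitales, §3.1 p. 579] -/
theorem archBzCompactSupport_zero : ArchBzCompactSupport (fun (_ : Finset W) (_ : W → Fin 3 → ℝ) => (0 : ℂ)) :=
  fun _ => ⟨0, fun _ _ => rfl⟩

/-- (I₄) rejects the constant family `1` as soon as a chart has a split place (unbounded split support). [cite: Bouaziz1994IntegralesOrbitales, §3.1 p. 579] -/
theorem not_archBzCompactSupport_one (w₀ : W) : ¬ ArchBzCompactSupport (fun (_ : Finset W) (_ : W → Fin 3 → ℝ) => (1 : ℂ)) := by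
  intro h
  obtain ⟨Rb, hRb⟩ := h {w₀}
  have h1 := hRb (fun _ _ => |Rb| + 1) ⟨w₀, Finset.mem_singleton_self w₀, ?_⟩
  · exact one_ne_zero h1
  · rw [abs_of_pos (by positivity)]
    exact (le_abs_self Rb).trans_lt (lt_add_one _)

end Support

/-! ## §2 Q1 — a NON-ZERO family satisfying (P), (W), (I₁)+(I₂), (I₄): the totally split bump family (the Q2 rejections sit with their clauses in §1) -/

/-- The bump of radii `¼ < ½` centred at `3∕2` (support `(1, 2)`, equal to `1` on `[5∕4, 7∕4]`). [cite: Shelstad1979, §4 Lemma 4.8 p. 26] -/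
def bzBumpCore : ContDiffBump (3 / 2 : ℝ) := ⟨1 / 4, 1 / 2, by norm_num, by norm_num⟩

/-- **The even bump `β(x) = b(x) + b(−x)`**: smooth, even, supported in `1 ≤ |x| ≤ 2`, `β(±3∕2) = 1`. [cite: Shelstad1979, §4 Lemma 4.8 p. 26] -/
def bzBump (x : ℝ) : ℝ := (bzBumpCore : ℝ → ℝ) x + (bzBumpCore : ℝ → ℝ) (-x)

/-- `β` is smooth. [cite: Shelstad1979, §4 Lemma 4.8 p. 26] -/
theorem contDiff_bzBump : ContDiff ℝ ∞ bzBump :=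
  bzBumpCore.contDiff.add (bzBumpCore.contDiff.comp contDiff_neg)

/-- `β` is even. [cite: Shelstad1979, §4 Lemma 4.8 p. 26] -/
theorem bzBump_neg (x : ℝ) : bzBump (-x) = bzBump x := by
  rw [bzBump, bzBump, neg_neg, add_comm]

/-- `β` vanishes for `|x| ≥ 2` (bounded split support). [cite: Bouaziz1994IntegralesOrbitales, §3.1 p. 579] -/
theorem bzBump_eq_zero_of_two_le {x : ℝ} (hx : 2 ≤ |x|) : bzBump x = 0 := by
  have h1 : (bzBumpCore : ℝ → ℝ) x = 0 := by
    refine bzBumpCore.zero_of_le_dist ?_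
    show (1 / 2 : ℝ) ≤ dist x (3 / 2)
    rw [Real.dist_eq]
    rcases le_abs'.1 hx with h | h
    · rw [abs_of_neg (by linarith)]; linarith
    · rw [abs_of_nonneg (by linarith)]; linarith
  have h2 : (bzBumpCore : ℝ → ℝ) (-x) = 0 := by
    refine bzBumpCore.zero_of_le_dist ?_
    show (1 / 2 : ℝ) ≤ dist (-x) (3 / 2)
    rw [Real.dist_eq]
    rcases le_abs'.1 hx with h | h
    · rw [abs_of_nonneg (by linarith)]; linarith
    · rw [abs_of_neg (by linarith)]; linarith
  rw [bzBump, h1, h2, add_zero]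

/-- `β` vanishes for `|x| ≤ 1`: FLAT at the real wall `x = 0` (so the future jump clause (I₃) reads `0 = jc · 0` on this family). [cite: Shelstad1979, §4 Lemma 4.8 p. 26] -/
theorem bzBump_eq_zero_of_le_one {x : ℝ} (hx : |x| ≤ 1) : bzBump x = 0 := by
  obtain ⟨h₁, h₂⟩ := abs_le.1 hx
  have h1 : (bzBumpCore : ℝ → ℝ) x = 0 := by
    refine bzBumpCore.zero_of_le_dist ?_
    show (1 / 2 : ℝ) ≤ dist x (3 / 2)
    rw [Real.dist_eq, abs_of_neg (by linarith)]
    linarith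
  have h2 : (bzBumpCore : ℝ → ℝ) (-x) = 0 := by
    refine bzBumpCore.zero_of_le_dist ?_
    show (1 / 2 : ℝ) ≤ dist (-x) (3 / 2)
    rw [Real.dist_eq, abs_of_neg (by linarith)]
    linarith
  rw [bzBump, h1, h2, add_zero]

/-- `β(3∕2) = 1`. [cite: Shelstad1979, §4 Lemma 4.8 p. 26] -/
theorem bzBump_three_halves : bzBump (3 / 2) = 1 := by
  have h1 : (bzBumpCore : ℝ → ℝ) (3 / 2) = 1 := bzBumpCore.one_of_mem_closedBall (Metric.mem_closedBall_self (by norm_num [bzBumpCore]))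
  have h2 : (bzBumpCore : ℝ → ℝ) (-(3 / 2)) = 0 := by
    refine bzBumpCore.zero_of_le_dist ?_
    show (1 / 2 : ℝ) ≤ dist (-(3 / 2) : ℝ) (3 / 2)
    rw [Real.dist_eq]
    norm_num
  rw [bzBump, h1, h2, add_zero]

section Family

variable [Fintype W] [DecidableEq W]

/-- **`bzBumpFamily` — the Q1 inhabitant**: on the totally split Cartan `S = univ` the product `∏_w β(x_w)` (ℂ-valued), `0` on every other Cartan class.
[cite: Shelstad1979, §4 Lemma 4.8 (b) p. 26] [cite: Bouaziz1994IntegralesOrbitales, Thm. 6.2.1 (i) p. 592] -/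
def bzBumpFamily (S : Finset W) (c : W → Fin 3 → ℝ) : ℂ :=
  if S = Finset.univ then ∏ w, (bzBump (c w 0) : ℂ) else 0

/-- The totally split member as a function. [cite: Shelstad1979, §4 Lemma 4.8 (b) p. 26] -/
theorem bzBumpFamily_univ : bzBumpFamily (W := W) Finset.univ = fun c => ∏ w, (bzBump (c w 0) : ℂ) := by
  funext c
  exact if_pos rfl

/-- The other members vanish. [cite: Shelstad1979, §4 Lemma 4.8 (b) p. 26] -/
theorem bzBumpFamily_of_ne_univ {S : Finset W} (hS : S ≠ Finset.univ) : bzBumpFamily S = fun (_ : W → Fin 3 → ℝ) => (0 : ℂ) := by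
  funext c
  exact if_neg hS

/-- The totally split member is smooth on the whole coordinate space. [cite: Shelstad1979, §4 Lemma 4.8 (b) p. 26] -/
theorem contDiff_bzBumpFamily_univ : ContDiff ℝ ∞ (bzBumpFamily (W := W) Finset.univ) := by
  rw [bzBumpFamily_univ]
  refine contDiff_prod fun w _ => ?_
  exact ofRealCLM.contDiff.comp (contDiff_bzBump.comp (contDiff_apply_apply ℝ ℝ w 0))

/-- **Q1, non-vacuity**: `bzBumpFamily ≠ 0` — at `x_w = 3∕2` for all `w` the totally split member equals `1`. [cite: Shelstad1979, §4 Lemma 4.8 (b) p. 26] -/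
theorem bzBumpFamily_univ_const_three_halves : bzBumpFamily (W := W) Finset.univ (fun _ _ => 3 / 2) = 1 := by
  rw [bzBumpFamily_univ]
  simp only [bzBump_three_halves, Complex.ofReal_one, Finset.prod_const_one]

/-- `bzBumpFamily` is not the zero family. [cite: Shelstad1979, §4 Lemma 4.8 (b) p. 26] -/
theorem bzBumpFamily_ne_zero : bzBumpFamily (W := W) ≠ fun _ _ => 0 := by
  intro h
  have h1 := congrFun (congrFun h Finset.univ) (fun _ _ => 3 / 2)
  rw [bzBumpFamily_univ_const_three_halves] at h1
  exact one_ne_zero h1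

/-- (P) for the bump family: it reads only the `x`-slots of the totally split chart, which no ANGULAR shift moves. [cite: Shelstad1979, §4 p. 22] -/
theorem archBzPeriodic_bzBumpFamily : ArchBzPeriodic (bzBumpFamily (W := W)) := by
  intro S c w i k h
  by_cases hS : S = Finset.univ
  · subst hS
    have hi : i ≠ 0 := h.resolve_left (fun hw => hw (Finset.mem_univ w))
    rw [bzBumpFamily_univ]
    refine Finset.prod_congr rfl fun w' _ => ?_
    have h0 : (c + angleShift w i k) w' 0 = c w' 0 := by
      rw [Pi.add_apply, Pi.add_apply]
      by_cases hw : w' = w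
      · subst hw
        rw [angleShift_apply_self_of_ne w' hi.symm, add_zero]
      · rw [angleShift_apply_of_ne hw, Pi.zero_apply, add_zero]
    rw [h0]
  · rw [bzBumpFamily_of_ne_univ hS]

/-- (W) for the bump family: flips only occur off the totally split chart (where the family is `0`); `x ↦ −x` is absorbed by the evenness of `β`.
[cite: Shelstad1979, §4 p. 23] -/
theorem archBzWeyl_bzBumpFamily : ArchBzWeyl (bzBumpFamily (W := W)) := by
  refine ⟨fun S c w hw => ?_, fun S c w hw => ?_⟩
  · have hS : S ≠ Finset.univ := fun h => hw (h ▸ Finset.mem_univ w)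
    rw [bzBumpFamily_of_ne_univ hS, zero_mul, mul_zero]
  · by_cases hS : S = Finset.univ
    · subst hS
      rw [bzBumpFamily_univ]
      refine Finset.prod_congr rfl fun w' _ => ?_
      by_cases h : w' = w
      · subst h
        rw [negXAt_apply_self, Matrix.cons_val_zero, bzBump_neg]
      · rw [negXAt_apply_of_ne h]
    · rw [bzBumpFamily_of_ne_univ hS]

/-- (I₁)+(I₂) for the bump family: the totally split member is globally `C^∞` (all derivatives continuous, hence bounded on compacta), the others are `0`.
[cite: Bouaziz1994IntegralesOrbitales, §3.1 p. 579] -/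
theorem archBzSmoothBounded_bzBumpFamily : ArchBzSmoothBounded (bzBumpFamily (W := W)) := by
  classical
  intro S
  by_cases hS : S = Finset.univ
  · subst hS
    refine ⟨contDiff_bzBumpFamily_univ.contDiffOn, fun n K hK => ?_⟩
    have hcont : Continuous fun c : W → Fin 3 → ℝ => ‖iteratedFDeriv ℝ n (bzBumpFamily (W := W) Finset.univ) c‖ :=
      (contDiff_bzBumpFamily_univ.continuous_iteratedFDeriv (mod_cast le_top)).norm
    exact (hK.bddAbove_image hcont.continuousOn).mono (Set.image_mono Set.inter_subset_left)
  · rw [bzBumpFamily_of_ne_univ hS]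
    exact archBzSmoothBounded_zero S

/-- (I₄) for the bump family with the bound `Rb = 2`: a split coordinate beyond `2` kills the factor `β(x_w)`. [cite: Bouaziz1994IntegralesOrbitales, §3.1 p. 579] -/
theorem archBzCompactSupport_bzBumpFamily : ArchBzCompactSupport (bzBumpFamily (W := W)) := by
  classical
  intro S
  refine ⟨2, fun c hc => ?_⟩
  by_cases hS : S = Finset.univ
  · subst hS
    obtain ⟨w, _, hw⟩ := hc
    rw [bzBumpFamily_univ]
    exact Finset.prod_eq_zero (Finset.mem_univ w) (by rw [bzBump_eq_zero_of_two_le hw.le, Complex.ofReal_zero])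
  · rw [bzBumpFamily_of_ne_univ hS]

end Family

end Literature.NumberTheory.Rogawski1990

end
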